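import Literature.NumberTheory.Sieve.GoldbachLinnikMeanSquareSplit
import Literature.NumberTheory.Sieve.PintzRuzsa2003Lemma12
import HarnessLib

/-!
# Goldbach–Linnik numbers: the diagonal count `r_{k,k}(0)` (Pintz–Ruzsa I, Lemma 12) in the
vocabulary of `GoldbachLinnikMeanSquareSplit.lean`

Topic `Literature/NumberTheory/Sieve`; support file for the named fact
`Literature.NumberTheory.Sieve.goldbach_linnik` (parity.S36). Sequel to
`GoldbachLinnikMeanSquareSplit.lean` (which defines `coincidences N k = r_{k,k}(0)` and
`offDiagPairs N k`).

Pintz–Ruzsa I, Lemma 12 (= Gallagher 1975, Lemma 5): `r_{k,k}(0) ≤ 2L^{2k-2}` (`k ≥ 2`). The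
combinatorial statement is PROVED in the tree as
`PintzRuzsa2003.card_powTwoCoincidences_le` (`PintzRuzsa2003Lemma12.lean`, for pairs of tuples in
`Fintype.piFinset (fun _ => Icc 1 L)`); since `GoldbachLinnik.expTuples N k` is literally that
`piFinset` with `L = powLen N` and `GoldbachLinnik.tupleSum ν = ∑ i, 2^{ν i}`, this file only
transcribes it (`coincidences_le_of_two_le`) and records the trivial count of off-diagonal pairs
(`card_offDiagPairs_le`), the two facts used by `GoldbachLinnikMeanSquare.lean`.
No definitions and no named facts are introduced.

## References

* J. Pintz, I. Z. Ruzsa, *On Linnik's approximation to Goldbach's problem, I*, Acta Arith. 109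
  (2003) 169–194, §9 (9.1), Lemma 12. [PintzRuzsa2003]
* P. X. Gallagher, *Primes and powers of 2*, Invent. Math. 29 (1975) 125–142, Lemma 5.
  [Gallagher1975]
-/

open Finset

namespace Literature.NumberTheory.Sieve

namespace GoldbachLinnik

/-- **Pintz–Ruzsa I, Lemma 12** for `k ≥ 2`: `r_{k,k}(0) ≤ 2 L^{2k-2}`, i.e.
`coincidences N k ≤ 2 (powLen N)^{2k-2}` — the tree's `PintzRuzsa2003.card_powTwoCoincidences_le`
read through the definitions `coincidences`, `expTuples`, `tupleSum`.
[cite: PintzRuzsa2003, Lemma 12] [cite: Gallagher1975, Lemma 5] -/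
theorem coincidences_le_of_two_le (N : ℕ) {k : ℕ} (hk : 2 ≤ k) :
    coincidences N k ≤ 2 * powLen N ^ (2 * k - 2) := by
  unfold coincidences expTuples tupleSum
  exact PintzRuzsa2003.card_powTwoCoincidences_le k (powLen N) hk

/-- The number of off-diagonal pairs of exponent tuples is at most `L^{2k}`. [folklore] -/
theorem card_offDiagPairs_le (N k : ℕ) : (offDiagPairs N k).card ≤ powLen N ^ (2 * k) := by
  calc (offDiagPairs N k).card ≤ (expTuples N k ×ˢ expTuples N k).card := card_filter_le _ _
    _ = powLen N ^ (2 * k) := by rw [card_product, card_expTuples, ← pow_add, two_mul]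

end GoldbachLinnik

end Literature.NumberTheory.Sieve
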